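import Literature.Probability.RandomPlanarGeometry.PlaneNonIntersectionNormalisations
import Literature.Probability.RandomPlanarGeometry.BlobTime
import Mathlib.Analysis.Convex.SpecificFunctions.Basic
import HarnessLib

/-!
# Cut times: Lawler's form of the `5/8` display and the mean number of cut times `≍ n^{3/8}`

Twelfth file of the `PlaneNonIntersection` story (named fact
`LSW2001_srw_nonIntersection_five_eighths`, `PlaneNonIntersection.lean`). Theorems, plus one
counting definition (`cutPairs`) and one splitting equivalence (`cutEquiv`) with bodies; the cut
times themselves are the tree's `BlobTime.cutTimes` / `BlobTime.cutCount` (`BlobTime.lean`). The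
random-walk input which Lawler–Schramm–Werner combine with `ζ₂ = 5/8` (their [Lwalkcut]) is
PRINTED for the cut times of a SINGLE walk — Lawler 1996, EJP 1:13, §1 (3):
`c₄ n^{-ζ} ≤ P{S[0,n] ∩ S[n+1,2n] = ∅} ≤ c₅ n^{-ζ}` (`d = 2, 3`; abstract: "P(S[0,n] ∩ S[n+1,2n]
= ∅) ≍ n^{-ζ}") — and the route that takes the fact (`SAWCutPointCondensation`, cruxes
`FreeEnergyScaling` / `CutPointWindowLimit`) speaks of the number
`C_n = #{j < n : S[0,j] ∩ S(j,n] = ∅}` of cut times of one `n`-step walk (`BlobTime.cutCount`).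
This file proves the dictionary and the first-moment consequence:

* `mem_cutTimes_toWalk_iff` — the tree's `BlobTime.cutTimes (toWalk ω)` (cut times `j < n` of
  the walk traced by `ω ∈ StepSeq 2 n`, `ω[0,j] ∩ ω(j,n] = ∅`, the route's convention: the
  terminal index is not counted) in terms of positions; `cutPairs a b` — Lawler's two-length count
  of pairs `(β, α)` of walks of lengths `a`, `b` from a common point with `β(0,a] ∩ α[0,b] = ∅`
  (`cutPairs n n = lawlerPairs n`, `cutPairs_self`).
* `card_filter_mem_cutTimes` — reading the past backwards from `S_j` and the future forwards
  (`cutEquiv`), `#{ω ∈ StepSeq 2 n : j ∈ cutTimes (toWalk ω)} = cutPairs (n-j) j` (`j < n`); in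
  particular `#{ω ∈ StepSeq 2 (2n) : n is a cut time} = lawlerPairs n`
  (`card_filter_half_mem_cutTimes`), so the named fact is EQUIVALENT to Lawler's printed (3) with
  `ζ = 5/8`: `LSW2001_srw_nonIntersection_five_eighths_iff_cutTime`.
* `cutPairs_div_le_of_le` — the normalised two-length probability is non-increasing in each
  length, whence `f(n) ≤ P{j ∈ cutTimes} ≤ f(min(j, n-j))` for `1 ≤ j < n`
  (`lawler_f_le_cutPairs_div`, `cutPairs_div_le_lawler_f_left/right`).
* `LSW2001_srw_nonIntersection_five_eighths.expected_cutCount` — ASSUMING the fact,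
  `c⁻¹ n^{3/8} ≤ E[C_n] = 4^{-n} Σ_ω cutCount (toWalk ω) ≤ c n^{3/8}` for `n ≥ 1` (linearity
  `sum_cutCount_eq`, the dictionary, monotonicity and `Σ_{m ≤ n} m^{-5/8} ≤ (8/3) n^{3/8}`,
  `sum_range_rpow_le`), and the same in the route's walk language
  (`…expected_cutCount_walks`, via `sum_walks_cutCount`). This is the standard first-moment half
  of Lawler's moment estimates (`E(Q_n) ≍ n^{2(1-ζ)}` in the exit-time parametrisation, §1 and
  §5, behind Thm 1.1 `P{Q_n ≥ c₆ n^{2(1-ζ)}} ≥ c₆`); the second-moment half and Thm 1.1 itself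
  need the long/short-range estimates of §4 and are not consequences of the fact alone — they are
  not attempted here.

Nothing here proves the fact (exponent `5/8` = LSW 2001 Thm 1 via `SLE₆`, plus Lawler's (3)).

## References

* G. F. Lawler, *Cut times for simple random walk*, Electron. J. Probab. **1** (1996), paper 13,
  abstract, §1 (2)–(3), Thms 1.1–1.3, §5 [Lawler1996CutTimes].
* G. F. Lawler, O. Schramm, W. Werner, *Values of Brownian intersection exponents II: Plane
  exponents*, Acta Math. **187** (2001), Thm 1 and §1 (display after Thm 1)
  [LawlerSchrammWerner2001PlaneExponents].
-/

noncomputable section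

open Finset Real Literature.Probability.LatticeModels Literature.Probability.LatticeModels.SRW
open scoped BigOperators

namespace Literature.Probability.RandomPlanarGeometry

namespace PlaneNonIntersection

/-! ### Cut times of one walk and Lawler's two-length count -/

/-- **Cut times of the walk traced by a step sequence**: for `ω ∈ StepSeq 2 n`, the tree's
`BlobTime.cutTimes (toWalk ω)` (times `j < n` with `ω[0,j] ∩ ω(j,n] = ∅`, Lawler's one-sided
convention, terminal index not counted — the route's `C_n`) in terms of positions.
[cite: Lawler1996CutTimes, §1] -/
theorem mem_cutTimes_toWalk_iff {n : ℕ} (ω : StepSeq 2 n) (j : ℕ) :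
    j ∈ BlobTime.cutTimes (toWalk ω) ↔ j < n ∧ ∀ i ≤ j, ∀ k ≤ n, j < k → pos ω i ≠ pos ω k := by
  rw [BlobTime.mem_cutTimes_iff, length_toWalk]
  constructor
  · rintro ⟨hj, h⟩
    refine ⟨hj, fun i hi k hk hjk => ?_⟩
    have h' := h i hi k hjk hk
    rwa [getVert_toWalk ω (by omega), getVert_toWalk ω hk] at h'
  · rintro ⟨hj, h⟩
    refine ⟨hj, fun i hi k hjk hk => ?_⟩
    rw [getVert_toWalk ω (by omega), getVert_toWalk ω hk]
    exact h i hi k hk hjk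

/-- Cut times are `< n`. [folklore] -/
theorem cutTimes_toWalk_subset_range {n : ℕ} (ω : StepSeq 2 n) :
    BlobTime.cutTimes (toWalk ω) ⊆ Finset.range n := by
  have h := BlobTime.cutTimes_subset_range (toWalk ω)
  rwa [length_toWalk] at h

/-- **Lawler's two-length count**: pairs `(β, α)` of walks of lengths `a` and `b` from a common
point with `β(0,a] ∩ α[0,b] = ∅` (`16^n`-times `P{S¹(0,n] ∩ S²[0,n] = ∅}` when `a = b = n`).
[cite: Lawler1996CutTimes, Thm 1.3 (6)] -/
def cutPairs (a b : ℕ) : ℕ :=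
  #{x : StepSeq 2 a × StepSeq 2 b | ∀ i ≤ a, 1 ≤ i → ∀ j ≤ b, pos x.1 i ≠ pos x.2 j}

/-- `cutPairs n n = lawlerPairs n`. [folklore] -/
theorem cutPairs_self (n : ℕ) : cutPairs n n = lawlerPairs n := rfl

/-- `cutPairs a b ≤ 4^a · 4^b`. [folklore] -/
theorem cutPairs_le (a b : ℕ) : cutPairs a b ≤ 4 ^ a * 4 ^ b := by
  calc cutPairs a b ≤ #(Finset.univ : Finset (StepSeq 2 a × StepSeq 2 b)) :=
        Finset.card_filter_le _ _
    _ = 4 ^ a * 4 ^ b := by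
        rw [Finset.card_univ, Fintype.card_prod, card_stepSeq, card_stepSeq]

/-- Probability form: `cutPairs a b / 4^(a+b) ≤ 1`. [folklore] -/
theorem cutPairs_div_le_one (a b : ℕ) : (cutPairs a b : ℝ) / 4 ^ (a + b) ≤ 1 := by
  rw [div_le_one (by positivity), pow_add]
  exact_mod_cast cutPairs_le a b

/-! ### The dictionary: cut time at `j` ↔ a non-intersecting pair of lengths `n - j`, `j` -/

/-- Splitting an `n`-step walk at time `j`: the future (an `(n-j)`-step walk) and the
time-reversed past (a `j`-step walk), both read from `ω(j)`. [folklore] -/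
def cutEquiv {n j : ℕ} (hj : j ≤ n) : StepSeq 2 n ≃ StepSeq 2 (n - j) × StepSeq 2 j :=
  (splitEquivS hj).trans ((Equiv.prodComm _ _).trans
    (Equiv.prodCongr (Equiv.refl _) (Function.Involutive.toPerm revNeg revNeg_revNeg)))

/-- `cutEquiv hj ω = (future, reversed past)`. [folklore] -/
@[simp] theorem cutEquiv_apply {n j : ℕ} (hj : j ≤ n) (ω : StepSeq 2 n) :
    cutEquiv hj ω = (sfxS ω j, revNeg (pfxS ω j hj)) := rfl

/-- **`j` is a cut time iff the future avoids the reversed past**: for `j < n`,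
`j ∈ cutTimes (toWalk ω) ↔ (sfxS ω j)(0,n-j] ∩ (revNeg (ω|ⱼ))[0,j] = ∅`. [folklore] -/
theorem mem_cutTimes_iff_pair {n j : ℕ} (hj : j < n) (ω : StepSeq 2 n) :
    j ∈ BlobTime.cutTimes (toWalk ω) ↔
      ∀ i ≤ n - j, 1 ≤ i → ∀ i' ≤ j, pos (sfxS ω j) i ≠ pos (revNeg (pfxS ω j hj.le)) i' := by
  rw [mem_cutTimes_toWalk_iff]
  constructor
  · rintro ⟨-, h⟩ i hi hi1 i' hi' heq
    have h1 : pos ω (j + i) = pos ω j + pos (sfxS ω j) i := pos_add_sfxS ω hj.le hi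
    have h2 : pos (revNeg (pfxS ω j hj.le)) i' = pos ω (j - i') - pos ω j := by
      rw [pos_revNeg _ i' hi', pos_pfxS ω hj.le (Nat.sub_le j i'), pos_pfxS ω hj.le le_rfl]
    refine h (j - i') (Nat.sub_le j i') (j + i) (by omega) (by omega) ?_
    rw [h1, heq, h2]
    abel
  · intro h
    refine ⟨hj, fun i'' hi'' k hk hjk heq => ?_⟩
    have h1 : pos ω k = pos ω j + pos (sfxS ω j) (k - j) := by
      have := pos_add_sfxS ω hj.le (k := k - j) (by omega)
      rwa [Nat.add_sub_cancel' hjk.le] at this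
    have h2 : pos (revNeg (pfxS ω j hj.le)) (j - i'') = pos ω i'' - pos ω j := by
      rw [pos_revNeg _ (j - i'') (Nat.sub_le _ _), pos_pfxS ω hj.le (Nat.sub_le _ _),
        pos_pfxS ω hj.le le_rfl, Nat.sub_sub_self hi'']
    refine h (k - j) (by omega) (by omega) (j - i'') (Nat.sub_le _ _) ?_
    rw [h2, heq, h1]
    abel

/-- **The dictionary**: for `j < n`, the `n`-step walks with a cut time at `j` are in bijection
with Lawler's pairs of lengths `n - j` and `j`:
`#{ω ∈ StepSeq 2 n : j ∈ cutTimes (toWalk ω)} = cutPairs (n-j) j`, i.e.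
`P{j is a cut time of S[0,n]} = P{S¹(0,n-j] ∩ S²[0,j] = ∅}`.
[cite: Lawler1996CutTimes, §1 and §5] -/
theorem card_filter_mem_cutTimes {n j : ℕ} (hj : j < n) :
    #{ω : StepSeq 2 n | j ∈ BlobTime.cutTimes (toWalk ω)} = cutPairs (n - j) j := by
  unfold cutPairs
  refine Finset.card_equiv (cutEquiv hj.le) fun ω => ?_
  simp only [Finset.mem_filter, Finset.mem_univ, true_and, cutEquiv_apply]
  exact mem_cutTimes_iff_pair hj ω

/-- **Lawler's (3) object**: `#{ω ∈ StepSeq 2 (2n) : n is a cut time of ω[0,2n]} = lawlerPairs n`,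
i.e. `P{S[0,n] ∩ S[n+1,2n] = ∅} = f(n) = P{S¹(0,n] ∩ S²[0,n] = ∅}`.
[cite: Lawler1996CutTimes, §1 (3)] -/
theorem card_filter_half_mem_cutTimes (n : ℕ) (hn : 1 ≤ n) :
    #{ω : StepSeq 2 (n + n) | n ∈ BlobTime.cutTimes (toWalk ω)} = lawlerPairs n := by
  rw [card_filter_mem_cutTimes (by omega : n < n + n), Nat.add_sub_cancel_left, cutPairs_self]

/-- `4^(n+n) = 16^n`. [folklore] -/
theorem four_pow_add_self (n : ℕ) : (4 : ℝ) ^ (n + n) = 16 ^ n := by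
  rw [← two_mul, pow_mul]; norm_num

/-- **Mean number of cut times as a sum over the cut position**:
`Σ_ω cutCount (toWalk ω) = Σ_{j<n} cutPairs (n-j) j`. [folklore] -/
theorem sum_cutCount_eq (n : ℕ) :
    ∑ ω : StepSeq 2 n, (BlobTime.cutCount (toWalk ω) : ℝ) =
      ∑ j ∈ Finset.range n, (cutPairs (n - j) j : ℝ) := by
  have h1 : ∀ ω : StepSeq 2 n, (BlobTime.cutCount (toWalk ω) : ℝ) =
      ∑ j ∈ Finset.range n, if j ∈ BlobTime.cutTimes (toWalk ω) then (1 : ℝ) else 0 := by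
    intro ω
    rw [BlobTime.cutCount, Finset.sum_boole, Finset.filter_mem_eq_inter,
      Finset.inter_eq_right.2 (cutTimes_toWalk_subset_range ω)]
  calc ∑ ω : StepSeq 2 n, (BlobTime.cutCount (toWalk ω) : ℝ)
      = ∑ ω : StepSeq 2 n, ∑ j ∈ Finset.range n,
          (if j ∈ BlobTime.cutTimes (toWalk ω) then (1 : ℝ) else 0) :=
        Finset.sum_congr rfl fun ω _ => h1 ω
    _ = ∑ j ∈ Finset.range n, ∑ ω : StepSeq 2 n,
          (if j ∈ BlobTime.cutTimes (toWalk ω) then (1 : ℝ) else 0) :=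
        Finset.sum_comm
    _ = ∑ j ∈ Finset.range n, (cutPairs (n - j) j : ℝ) := by
        refine Finset.sum_congr rfl fun j hj => ?_
        rw [Finset.sum_boole, card_filter_mem_cutTimes (Finset.mem_range.1 hj)]

/-! ### Monotonicity of the two-length count in each length -/

/-- `cutPairs` as a double sum of indicators. [folklore] -/
theorem cutPairs_eq_sum (a b : ℕ) : (cutPairs a b : ℝ) =
    ∑ β : StepSeq 2 a, ∑ α : StepSeq 2 b,
      if ∀ i ≤ a, 1 ≤ i → ∀ j ≤ b, pos β i ≠ pos α j then (1 : ℝ) else 0 := by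
  rw [cutPairs, Finset.card_filter, Nat.cast_sum, Fintype.sum_prod_type]
  refine Finset.sum_congr rfl fun β _ => Finset.sum_congr rfl fun α _ => ?_
  dsimp only
  split_ifs <;> simp

/-- **`cutPairs (a+1) b ≤ 4 · cutPairs a b`**: dropping the last step of the first walk only
enlarges the count. [folklore] -/
theorem cutPairs_succ_left_le (a b : ℕ) : (cutPairs (a + 1) b : ℝ) ≤ 4 * cutPairs a b := by
  have ha : a ≤ a + 1 := Nat.le_succ a
  have hle : ∀ (β : StepSeq 2 (a + 1)) (α : StepSeq 2 b),
      (if ∀ i ≤ a + 1, 1 ≤ i → ∀ j ≤ b, pos β i ≠ pos α j then (1 : ℝ) else 0) ≤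
        if ∀ i ≤ a, 1 ≤ i → ∀ j ≤ b, pos (pfxS β a ha) i ≠ pos α j then (1 : ℝ) else 0 := by
    intro β α
    split_ifs with h1 h2
    · exact le_rfl
    · exact absurd (fun i hi hi1 j hj => by
        rw [pos_pfxS β ha hi]; exact h1 i (hi.trans ha) hi1 j hj) h2
    · exact zero_le_one
    · exact le_rfl
  calc (cutPairs (a + 1) b : ℝ)
      = ∑ β : StepSeq 2 (a + 1), ∑ α : StepSeq 2 b,
          (if ∀ i ≤ a + 1, 1 ≤ i → ∀ j ≤ b, pos β i ≠ pos α j then (1 : ℝ) else 0) :=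
        cutPairs_eq_sum (a + 1) b
    _ ≤ ∑ β : StepSeq 2 (a + 1), ∑ α : StepSeq 2 b,
          (if ∀ i ≤ a, 1 ≤ i → ∀ j ≤ b, pos (pfxS β a ha) i ≠ pos α j then (1 : ℝ) else 0) :=
        Finset.sum_le_sum fun β _ => Finset.sum_le_sum fun α _ => hle β α
    _ = 4 ^ (a + 1 - a) * ∑ β' : StepSeq 2 a, ∑ α : StepSeq 2 b,
          (if ∀ i ≤ a, 1 ≤ i → ∀ j ≤ b, pos β' i ≠ pos α j then (1 : ℝ) else 0) :=
        sum_comp_pfxS ha (fun β' => ∑ α : StepSeq 2 b,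
          if ∀ i ≤ a, 1 ≤ i → ∀ j ≤ b, pos β' i ≠ pos α j then (1 : ℝ) else 0)
    _ = 4 * cutPairs a b := by rw [cutPairs_eq_sum]; norm_num

/-- **`cutPairs a (b+1) ≤ 4 · cutPairs a b`**: dropping the last step of the second walk only
enlarges the count. [folklore] -/
theorem cutPairs_succ_right_le (a b : ℕ) : (cutPairs a (b + 1) : ℝ) ≤ 4 * cutPairs a b := by
  have hb : b ≤ b + 1 := Nat.le_succ b
  have hle : ∀ (β : StepSeq 2 a) (α : StepSeq 2 (b + 1)),
      (if ∀ i ≤ a, 1 ≤ i → ∀ j ≤ b + 1, pos β i ≠ pos α j then (1 : ℝ) else 0) ≤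
        if ∀ i ≤ a, 1 ≤ i → ∀ j ≤ b, pos β i ≠ pos (pfxS α b hb) j then (1 : ℝ) else 0 := by
    intro β α
    split_ifs with h1 h2
    · exact le_rfl
    · exact absurd (fun i hi hi1 j hj => by
        rw [pos_pfxS α hb hj]; exact h1 i hi hi1 j (hj.trans hb)) h2
    · exact zero_le_one
    · exact le_rfl
  calc (cutPairs a (b + 1) : ℝ)
      = ∑ β : StepSeq 2 a, ∑ α : StepSeq 2 (b + 1),
          (if ∀ i ≤ a, 1 ≤ i → ∀ j ≤ b + 1, pos β i ≠ pos α j then (1 : ℝ) else 0) :=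
        cutPairs_eq_sum a (b + 1)
    _ ≤ ∑ β : StepSeq 2 a, ∑ α : StepSeq 2 (b + 1),
          (if ∀ i ≤ a, 1 ≤ i → ∀ j ≤ b, pos β i ≠ pos (pfxS α b hb) j then (1 : ℝ) else 0) :=
        Finset.sum_le_sum fun β _ => Finset.sum_le_sum fun α _ => hle β α
    _ = ∑ β : StepSeq 2 a, 4 ^ (b + 1 - b) * ∑ α' : StepSeq 2 b,
          (if ∀ i ≤ a, 1 ≤ i → ∀ j ≤ b, pos β i ≠ pos α' j then (1 : ℝ) else 0) :=
        Finset.sum_congr rfl fun β _ => sum_comp_pfxS hb (fun α' =>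
          if ∀ i ≤ a, 1 ≤ i → ∀ j ≤ b, pos β i ≠ pos α' j then (1 : ℝ) else 0)
    _ = 4 * cutPairs a b := by rw [cutPairs_eq_sum, ← Finset.mul_sum]; norm_num

/-- Probability form in the first length. [folklore] -/
theorem cutPairs_div_succ_left_le (a b : ℕ) :
    (cutPairs (a + 1) b : ℝ) / 4 ^ (a + 1 + b) ≤ (cutPairs a b : ℝ) / 4 ^ (a + b) := by
  rw [div_le_div_iff₀ (by positivity) (by positivity),
    show (4 : ℝ) ^ (a + 1 + b) = 4 * 4 ^ (a + b) by rw [Nat.add_right_comm, pow_succ]; ring]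
  have := cutPairs_succ_left_le a b
  have h4 : (0 : ℝ) ≤ 4 ^ (a + b) := by positivity
  nlinarith

/-- Probability form in the second length. [folklore] -/
theorem cutPairs_div_succ_right_le (a b : ℕ) :
    (cutPairs a (b + 1) : ℝ) / 4 ^ (a + (b + 1)) ≤ (cutPairs a b : ℝ) / 4 ^ (a + b) := by
  rw [div_le_div_iff₀ (by positivity) (by positivity),
    show (4 : ℝ) ^ (a + (b + 1)) = 4 * 4 ^ (a + b) by rw [← Nat.add_assoc, pow_succ]; ring]
  have := cutPairs_succ_right_le a b
  have h4 : (0 : ℝ) ≤ 4 ^ (a + b) := by positivity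
  nlinarith

/-- **Two lengths, monotonicity**: for `a ≤ a'` and `b ≤ b'`,
`cutPairs a' b' / 4^{a'+b'} ≤ cutPairs a b / 4^{a+b}`. [folklore] -/
theorem cutPairs_div_le_of_le {a a' b b' : ℕ} (ha : a ≤ a') (hb : b ≤ b') :
    (cutPairs a' b' : ℝ) / 4 ^ (a' + b') ≤ (cutPairs a b : ℝ) / 4 ^ (a + b) := by
  have hleft : ∀ m b₀ : ℕ, (cutPairs (a + m) b₀ : ℝ) / 4 ^ (a + m + b₀) ≤
      (cutPairs a b₀ : ℝ) / 4 ^ (a + b₀) := by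
    intro m b₀
    induction m with
    | zero => simp
    | succ m ih =>
        calc (cutPairs (a + (m + 1)) b₀ : ℝ) / 4 ^ (a + (m + 1) + b₀)
            = (cutPairs (a + m + 1) b₀ : ℝ) / 4 ^ (a + m + 1 + b₀) := by rw [← Nat.add_assoc]
          _ ≤ (cutPairs (a + m) b₀ : ℝ) / 4 ^ (a + m + b₀) := cutPairs_div_succ_left_le _ _
          _ ≤ _ := ih
  have hright : ∀ m : ℕ, (cutPairs a (b + m) : ℝ) / 4 ^ (a + (b + m)) ≤
      (cutPairs a b : ℝ) / 4 ^ (a + b) := by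
    intro m
    induction m with
    | zero => simp
    | succ m ih =>
        calc (cutPairs a (b + (m + 1)) : ℝ) / 4 ^ (a + (b + (m + 1)))
            = (cutPairs a (b + m + 1) : ℝ) / 4 ^ (a + (b + m + 1)) := by rw [← Nat.add_assoc]
          _ ≤ (cutPairs a (b + m) : ℝ) / 4 ^ (a + (b + m)) := cutPairs_div_succ_right_le _ _
          _ ≤ _ := ih
  obtain ⟨m₁, rfl⟩ := Nat.exists_eq_add_of_le ha
  obtain ⟨m₂, rfl⟩ := Nat.exists_eq_add_of_le hb
  calc (cutPairs (a + m₁) (b + m₂) : ℝ) / 4 ^ (a + m₁ + (b + m₂))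
      ≤ (cutPairs a (b + m₂) : ℝ) / 4 ^ (a + (b + m₂)) := hleft m₁ (b + m₂)
    _ ≤ (cutPairs a b : ℝ) / 4 ^ (a + b) := hright m₂

/-- **Lower comparison**: every cut position is at least as likely as the half-time one at double
length, `f(n) = lawlerPairs n / 16^n ≤ P{j ∈ cutTimes} = cutPairs (n-j) j / 4^n` (`j ≤ n`).
[folklore] -/
theorem lawler_f_le_cutPairs_div {n j : ℕ} (hj : j ≤ n) :
    (lawlerPairs n : ℝ) / 16 ^ n ≤ (cutPairs (n - j) j : ℝ) / 4 ^ n := by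
  have h := cutPairs_div_le_of_le (a := n - j) (a' := n) (b := j) (b' := n) (Nat.sub_le n j) hj
  rw [Nat.sub_add_cancel hj, cutPairs_self, four_pow_add_self] at h
  exact h

/-- **Upper comparison, early cut positions**: `P{j ∈ cutTimes} ≤ f(j)` for `j ≤ n - j`.
[folklore] -/
theorem cutPairs_div_le_lawler_f_left {n j : ℕ} (hj : j ≤ n - j) :
    (cutPairs (n - j) j : ℝ) / 4 ^ n ≤ (lawlerPairs j : ℝ) / 16 ^ j := by
  have h := cutPairs_div_le_of_le (a := j) (a' := n - j) (b := j) (b' := j) hj le_rfl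
  rw [Nat.sub_add_cancel (by omega : j ≤ n), cutPairs_self, four_pow_add_self] at h
  exact h

/-- **Upper comparison, late cut positions**: `P{j ∈ cutTimes} ≤ f(n-j)` for `n - j ≤ j ≤ n`.
[folklore] -/
theorem cutPairs_div_le_lawler_f_right {n j : ℕ} (hjn : j ≤ n) (hj : n - j ≤ j) :
    (cutPairs (n - j) j : ℝ) / 4 ^ n ≤ (lawlerPairs (n - j) : ℝ) / 16 ^ (n - j) := by
  have h := cutPairs_div_le_of_le (a := n - j) (a' := n - j) (b := n - j) (b' := j) le_rfl hj
  rw [Nat.sub_add_cancel hjn, cutPairs_self, four_pow_add_self] at h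
  exact h

/-! ### The elementary sum `Σ_{m ≤ M} m^{-5/8} ≤ (8/3) M^{3/8}` -/

/-- `Σ_{m=1}^{M} m^{-5/8} ≤ (8/3) M^{3/8}` (each term is at most `∫_{m-1}^m x^{-5/8} dx`, by
concavity of `x ↦ x^{3/8}` in the form of Bernoulli's inequality). [folklore] -/
theorem sum_range_rpow_le (M : ℕ) :
    ∑ m ∈ Finset.range M, ((m : ℝ) + 1) ^ (-(5 / 8 : ℝ)) ≤ 8 / 3 * (M : ℝ) ^ (3 / 8 : ℝ) := by
  induction M with
  | zero =>
      rw [Finset.range_zero, Finset.sum_empty, Nat.cast_zero, Real.zero_rpow (by norm_num)]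
      norm_num
  | succ M ih =>
      rw [Finset.sum_range_succ]
      have hx : (0 : ℝ) < (M : ℝ) + 1 := by positivity
      have hM : (M : ℝ) = ((M : ℝ) + 1) * (1 + -((M : ℝ) + 1)⁻¹) := by
        rw [mul_add, mul_neg, mul_one, mul_inv_cancel₀ hx.ne']
        ring
      have hinv : ((M : ℝ) + 1)⁻¹ ≤ 1 := inv_le_one_of_one_le₀ (by linarith)
      have hs1 : (-1 : ℝ) ≤ -((M : ℝ) + 1)⁻¹ := by linarith
      have hs0 : (0 : ℝ) ≤ 1 + -((M : ℝ) + 1)⁻¹ := by linarith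
      have hB := rpow_one_add_le_one_add_mul_self hs1 (p := 3 / 8) (by norm_num) (by norm_num)
      have hpos : 0 ≤ ((M : ℝ) + 1) ^ (3 / 8 : ℝ) := Real.rpow_nonneg hx.le _
      have e1 : (M : ℝ) ^ (3 / 8 : ℝ) =
          ((M : ℝ) + 1) ^ (3 / 8 : ℝ) * (1 + -((M : ℝ) + 1)⁻¹) ^ (3 / 8 : ℝ) := by
        rw [← Real.mul_rpow hx.le hs0, ← hM]
      have e2 : ((M : ℝ) + 1) ^ (-(5 / 8) : ℝ) = ((M : ℝ) + 1) ^ (3 / 8 : ℝ) * ((M : ℝ) + 1)⁻¹ := by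
        rw [show (-(5 / 8) : ℝ) = 3 / 8 + (-1) by norm_num, Real.rpow_add hx, Real.rpow_neg_one]
      have h3 := mul_le_mul_of_nonneg_left hB hpos
      have key : (M : ℝ) ^ (3 / 8 : ℝ) ≤
          ((M : ℝ) + 1) ^ (3 / 8 : ℝ) - 3 / 8 * ((M : ℝ) + 1) ^ (-(5 / 8) : ℝ) := by
        rw [e1, e2]
        have h4 : ((M : ℝ) + 1) ^ (3 / 8 : ℝ) * (1 + 3 / 8 * -((M : ℝ) + 1)⁻¹) =
            ((M : ℝ) + 1) ^ (3 / 8 : ℝ) -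
              3 / 8 * (((M : ℝ) + 1) ^ (3 / 8 : ℝ) * ((M : ℝ) + 1)⁻¹) := by
          ring
        linarith [h3, h4]
      push_cast
      linarith [key, ih]

/-- The same sum written over `Ico 1 n`: `Σ_{j=1}^{n-1} j^{-5/8} ≤ (8/3) n^{3/8}`. [folklore] -/
theorem sum_Ico_rpow_le (n : ℕ) :
    ∑ j ∈ Finset.Ico 1 n, (j : ℝ) ^ (-(5 / 8 : ℝ)) ≤ 8 / 3 * (n : ℝ) ^ (3 / 8 : ℝ) := by
  rw [Finset.sum_Ico_eq_sum_range]
  have h1 : ∑ k ∈ Finset.range (n - 1), (((1 + k : ℕ) : ℝ)) ^ (-(5 / 8 : ℝ)) =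
      ∑ k ∈ Finset.range (n - 1), ((k : ℝ) + 1) ^ (-(5 / 8 : ℝ)) :=
    Finset.sum_congr rfl fun k _ => by push_cast; rw [add_comm]
  rw [h1]
  refine (sum_range_rpow_le (n - 1)).trans ?_
  have hmono : ((n - 1 : ℕ) : ℝ) ^ (3 / 8 : ℝ) ≤ (n : ℝ) ^ (3 / 8 : ℝ) :=
    Real.rpow_le_rpow (Nat.cast_nonneg _) (by exact_mod_cast Nat.sub_le n 1) (by norm_num)
  linarith

/-! ### The mean number of cut times, assuming the fact -/

/-- **Per-position bound from the fact**: if `f(m) ≤ c₀ m^{-5/8}` for all `m ≥ 1`, then for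
`1 ≤ j ≤ n - 1`, `P{j ∈ cutTimes} ≤ c₀ (j^{-5/8} + (n-j)^{-5/8})`. [folklore] -/
theorem cutPairs_div_le_of_lawler_f_le {c₀ : ℝ} (hc₀ : 0 < c₀)
    (hf : ∀ m : ℕ, 1 ≤ m → (lawlerPairs m : ℝ) / 16 ^ m ≤ c₀ * (m : ℝ) ^ (-(5 / 8 : ℝ)))
    {n j : ℕ} (hj1 : 1 ≤ j) (hjn : j < n) :
    (cutPairs (n - j) j : ℝ) / 4 ^ n ≤
      c₀ * ((j : ℝ) ^ (-(5 / 8 : ℝ)) + ((n - j : ℕ) : ℝ) ^ (-(5 / 8 : ℝ))) := by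
  have hA : 0 ≤ c₀ * (j : ℝ) ^ (-(5 / 8 : ℝ)) :=
    mul_nonneg hc₀.le (Real.rpow_nonneg (Nat.cast_nonneg _) _)
  have hB : 0 ≤ c₀ * ((n - j : ℕ) : ℝ) ^ (-(5 / 8 : ℝ)) :=
    mul_nonneg hc₀.le (Real.rpow_nonneg (Nat.cast_nonneg _) _)
  rcases le_total j (n - j) with h | h
  · have h1 := (cutPairs_div_le_lawler_f_left h).trans (hf j hj1)
    linarith
  · have h1 := (cutPairs_div_le_lawler_f_right hjn.le h).trans (hf (n - j) (by omega))
    linarith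

/-- **Mean number of cut times `≍ n^{3/8}`, assuming the fact** (Lawler's first-moment estimate,
`d = 2`, `ζ = 5/8`): if `LSW2001_srw_nonIntersection_five_eighths` holds then for some `c > 0`
and all `n ≥ 1`,
`c⁻¹ n^{3/8} ≤ E[C_n] = 4^{-n} Σ_{ω ∈ StepSeq 2 n} cutCount (toWalk ω) ≤ c n^{3/8}`.
Proof: `E[C_n] = Σ_{j<n} P{j ∈ cutTimes}` with `f(n) ≤ P{j ∈ cutTimes} ≤ f(min(j,n-j))`
(`j ≥ 1`; `≤ 1` for `j = 0`) and `Σ_{m<n} m^{-5/8} ≤ (8/3) n^{3/8}`. The printed theorems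
(Lawler 1996, Thm 1.1: `P{Q_n ≥ c₆ n^{2(1-ζ)}} ≥ c₆`, from `E(Q_n) ≥ c n^{2(1-ζ)}` and
`E(Q_n²) ≤ c n^{4(1-ζ)}` in the exit-time parametrisation) are stronger and are not claimed.
[cite: Lawler1996CutTimes, §1 (3) and Thm 1.1; §5] -/
theorem _root_.Literature.Probability.RandomPlanarGeometry.LSW2001_srw_nonIntersection_five_eighths.expected_cutCount
    (h : LSW2001_srw_nonIntersection_five_eighths) :
    ∃ c : ℝ, 0 < c ∧ ∀ n : ℕ, 1 ≤ n →
      c⁻¹ * (n : ℝ) ^ (3 / 8 : ℝ) ≤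
          (∑ ω : StepSeq 2 n, (BlobTime.cutCount (toWalk ω) : ℝ)) / 4 ^ n ∧
        (∑ ω : StepSeq 2 n, (BlobTime.cutCount (toWalk ω) : ℝ)) / 4 ^ n ≤
          c * (n : ℝ) ^ (3 / 8 : ℝ) := by
  obtain ⟨c₀, hc₀, hf⟩ := LSW2001_srw_nonIntersection_five_eighths_iff_lawler_f.1 h
  refine ⟨1 + 6 * c₀, by positivity, fun n hn => ?_⟩
  have hn0 : (0 : ℝ) < n := by exact_mod_cast hn
  have hsplit : (n : ℝ) ^ (3 / 8 : ℝ) = n * (n : ℝ) ^ (-(5 / 8 : ℝ)) := by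
    rw [show (3 / 8 : ℝ) = 1 + -(5 / 8) by norm_num, Real.rpow_add hn0, Real.rpow_one]
  have hone : (1 : ℝ) ≤ (n : ℝ) ^ (3 / 8 : ℝ) :=
    Real.one_le_rpow (by exact_mod_cast hn) (by norm_num)
  rw [sum_cutCount_eq, Finset.sum_div]
  constructor
  · -- lower bound: each term is at least `f(n) ≥ c₀⁻¹ n^{-5/8}`
    have hterm : ∀ j ∈ Finset.range n,
        c₀⁻¹ * (n : ℝ) ^ (-(5 / 8 : ℝ)) ≤ (cutPairs (n - j) j : ℝ) / 4 ^ n := fun j hj =>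
      ((hf n hn).1).trans (lawler_f_le_cutPairs_div (Finset.mem_range.1 hj).le)
    have hsum := Finset.sum_le_sum hterm
    rw [Finset.sum_const, Finset.card_range, nsmul_eq_mul] at hsum
    have hcinv : (1 + 6 * c₀)⁻¹ ≤ c₀⁻¹ := inv_anti₀ hc₀ (by linarith)
    have hr : 0 ≤ (n : ℝ) ^ (3 / 8 : ℝ) := Real.rpow_nonneg hn0.le _
    calc (1 + 6 * c₀)⁻¹ * (n : ℝ) ^ (3 / 8 : ℝ) ≤ c₀⁻¹ * (n : ℝ) ^ (3 / 8 : ℝ) :=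
          mul_le_mul_of_nonneg_right hcinv hr
      _ = (n : ℝ) * (c₀⁻¹ * (n : ℝ) ^ (-(5 / 8 : ℝ))) := by rw [hsplit]; ring
      _ ≤ ∑ j ∈ Finset.range n, (cutPairs (n - j) j : ℝ) / 4 ^ n := hsum
  · -- upper bound: `j = 0` contributes at most `1`, `j ≥ 1` at most `c₀ (j^{-5/8} + (n-j)^{-5/8})`
    have hf' : ∀ m : ℕ, 1 ≤ m → (lawlerPairs m : ℝ) / 16 ^ m ≤ c₀ * (m : ℝ) ^ (-(5 / 8 : ℝ)) :=
      fun m hm => (hf m hm).2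
    obtain ⟨n', rfl⟩ : ∃ n', n = n' + 1 := ⟨n - 1, by omega⟩
    rw [Finset.range_eq_Ico, Finset.sum_eq_sum_Ico_succ_bot (by omega : 0 < n' + 1)]
    have h0 : (cutPairs (n' + 1 - 0) 0 : ℝ) / 4 ^ (n' + 1) ≤ 1 := by
      have := cutPairs_div_le_one (n' + 1 - 0) 0
      rwa [Nat.sub_zero, Nat.add_zero] at this ⊢
    have hrest : ∑ j ∈ Finset.Ico 1 (n' + 1), (cutPairs (n' + 1 - j) j : ℝ) / 4 ^ (n' + 1) ≤
        c₀ * ∑ j ∈ Finset.Ico 1 (n' + 1), (j : ℝ) ^ (-(5 / 8 : ℝ)) +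
          c₀ * ∑ j ∈ Finset.Ico 1 (n' + 1), ((n' + 1 - j : ℕ) : ℝ) ^ (-(5 / 8 : ℝ)) := by
      rw [← mul_add, ← Finset.sum_add_distrib, Finset.mul_sum]
      exact Finset.sum_le_sum fun j hj =>
        cutPairs_div_le_of_lawler_f_le hc₀ hf' (Finset.mem_Ico.1 hj).1 (Finset.mem_Ico.1 hj).2
    have hS1 := sum_Ico_rpow_le (n' + 1)
    have hS2 : ∑ j ∈ Finset.Ico 1 (n' + 1), ((n' + 1 - j : ℕ) : ℝ) ^ (-(5 / 8 : ℝ)) ≤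
        8 / 3 * ((n' + 1 : ℕ) : ℝ) ^ (3 / 8 : ℝ) := by
      rw [Finset.sum_Ico_reflect (fun j : ℕ => (j : ℝ) ^ (-(5 / 8 : ℝ))) 1 (m := n' + 1)
          (n := n' + 1) (by omega),
        show n' + 1 + 1 - (n' + 1) = 1 by omega, show n' + 1 + 1 - 1 = n' + 1 by omega]
      exact hS1
    have hr : 0 ≤ ((n' + 1 : ℕ) : ℝ) ^ (3 / 8 : ℝ) := Real.rpow_nonneg (Nat.cast_nonneg _) _
    have hc₀S := add_le_add (mul_le_mul_of_nonneg_left hS1 hc₀.le)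
      (mul_le_mul_of_nonneg_left hS2 hc₀.le)
    rw [Nat.zero_add]
    linarith [h0, hrest, hc₀S, hone, mul_nonneg hc₀.le hr]

/-! ### The route's walk language -/

/-- **Transfer to walks**: summed over all `n`-step nearest-neighbour walks `q` of `ℤ²` from the
origin (indexed by endpoint in `box 2 n`), the cut count is `Σ_ω cutCount (toWalk ω)`. (The route's
inlined term `#{j < |q| : ∀ i ≤ j, ∀ k ∈ (j, |q|], q(i) ≠ q(k)}` is `BlobTime.cutCount q` by
`BlobTime.cutCount_eq`.) [folklore] -/
theorem sum_walks_cutCount (n : ℕ) :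
    ∑ v ∈ box 2 n, ∑ q ∈ (zdGraph 2).finsetWalkLength n (0 : Site 2) v, (BlobTime.cutCount q : ℝ) =
      ∑ ω : StepSeq 2 n, (BlobTime.cutCount (toWalk ω) : ℝ) :=
  sum_walks_eq_sum_stepSeq fun (x : Site 2) (q : (zdGraph 2).Walk (0 : Site 2) x) =>
    (BlobTime.cutCount q : ℝ)

/-- **Mean number of cut times `≍ n^{3/8}` in the route's walk language, assuming the fact**:
`c⁻¹ n^{3/8} ≤ 4^{-n} Σ_{q : n-step walks of ℤ² from 0} cutCount q ≤ c n^{3/8}` (`n ≥ 1`).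
[cite: Lawler1996CutTimes, §1 (3) and Thm 1.1; §5] -/
theorem _root_.Literature.Probability.RandomPlanarGeometry.LSW2001_srw_nonIntersection_five_eighths.expected_cutCount_walks
    (h : LSW2001_srw_nonIntersection_five_eighths) :
    ∃ c : ℝ, 0 < c ∧ ∀ n : ℕ, 1 ≤ n →
      c⁻¹ * (n : ℝ) ^ (3 / 8 : ℝ) ≤
          (∑ v ∈ box 2 n, ∑ q ∈ (zdGraph 2).finsetWalkLength n (0 : Site 2) v,
            (BlobTime.cutCount q : ℝ)) / 4 ^ n ∧
        (∑ v ∈ box 2 n, ∑ q ∈ (zdGraph 2).finsetWalkLength n (0 : Site 2) v,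
            (BlobTime.cutCount q : ℝ)) / 4 ^ n ≤ c * (n : ℝ) ^ (3 / 8 : ℝ) := by
  obtain ⟨c, hc, hb⟩ := h.expected_cutCount
  refine ⟨c, hc, fun n hn => ?_⟩
  rw [sum_walks_cutCount n]
  exact hb n hn

end PlaneNonIntersection

/-! ### The fact in Lawler's printed form (3) -/

open PlaneNonIntersection in
/-- **The Lawler–Schramm–Werner display ⟺ Lawler's (3) with `ζ = 5/8`.** The named fact
`LSW2001_srw_nonIntersection_five_eighths` (two walks from neighbouring vertices, closed ranges
disjoint, `≍ k^{-5/8}`) is EQUIVALENT to the two-sided estimate for ONE `2n`-step simple random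
walk to have a cut time at `n`:
`c⁻¹ n^{-5/8} ≤ P{S[0,n] ∩ S[n+1,2n] = ∅} = #{ω ∈ StepSeq 2 (2n) : n ∈ cutTimes (toWalk ω)}/4^{2n}`
`≤ c n^{-5/8}`
(`n ≥ 1`) — the form in which the random-walk estimate is printed (Lawler 1996, (3):
`c₄ n^{-ζ} ≤ P{S[0,n] ∩ S[n+1,2n] = ∅} ≤ c₅ n^{-ζ}`, `d = 2, 3`; abstract), with the value
`ζ = ζ₂ = 5/8` of LSW 2001, Thm 1. This is the elementary equivalence only (cut-time dictionary
`card_filter_half_mem_cutTimes` and the sandwich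
`LSW2001_srw_nonIntersection_five_eighths_iff_lawler_f`);
it proves neither side.
[cite: Lawler1996CutTimes, §1 (3)] [cite: LawlerSchrammWerner2001PlaneExponents, Thm 1 and §1] -/
theorem LSW2001_srw_nonIntersection_five_eighths_iff_cutTime :
    LSW2001_srw_nonIntersection_five_eighths ↔
      ∃ c : ℝ, 0 < c ∧ ∀ n : ℕ, 1 ≤ n →
        c⁻¹ * (n : ℝ) ^ (-(5 / 8 : ℝ)) ≤
            (#{ω : StepSeq 2 (n + n) | n ∈ BlobTime.cutTimes (toWalk ω)} : ℝ) / 4 ^ (n + n) ∧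
          (#{ω : StepSeq 2 (n + n) | n ∈ BlobTime.cutTimes (toWalk ω)} : ℝ) / 4 ^ (n + n) ≤
            c * (n : ℝ) ^ (-(5 / 8 : ℝ)) := by
  rw [LSW2001_srw_nonIntersection_five_eighths_iff_lawler_f]
  refine exists_congr fun c => and_congr_right fun _ => forall_congr' fun n =>
    forall_congr' fun hn => ?_
  rw [card_filter_half_mem_cutTimes n hn, four_pow_add_self]

end Literature.Probability.RandomPlanarGeometry

end
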